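import Literature.NumberTheory.LFunctions.ImaginaryQuadraticGrossencharakterFunctionalEquation
import Literature.NumberTheory.EllipticCurves.CMNewformGamma0PrimitiveIsNewformProofs
import Literature.NumberTheory.GaloisRepresentations.HeckeLFunctionValueOfNegativeWeight
import Literature.NumberTheory.GaloisRepresentations.HeckeCharacterConductorRayPrimitive
import Literature.NumberTheory.GaloisRepresentations.HeckeCharacterGrossencharakterOfInfinityType
import HarnessLib

/-!
# STUB-IDEAS `stub_modThree` · k = 1 · generation 13 — typed helper targets (companion of `STUB-IDEAS-stub_modThree-1.md`)

Crux `FreyModularity` (stmt-ABC-11340), line `Sketch`, stub `stub_modThree` (Langlands–Tunnell at `ρ̄_{E,3}`).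
k1 road (g2/g6, kernel-checked): `stub ⇐ StubModThreeSurj ∧ TwoGroupBranch`; the 2-group half reduces (g10 E0–E5 +
`ModularForms.shimura1972_heckeTheta_isNewform0_of_primitive_of_heckeFE`, landed) to the named fact
`Literature.NumberTheory.EllipticCurves.Hecke_functionalEquation_infinityType_conductor` (0 `_holds` at 2026-09-01T01:00Z).

GENERATION-13 DELTA (2026-09-01 00:28–00:55Z, two OTHER cells):
* `LFunctions/ImaginaryQuadraticGrossencharakterFunctionalEquation.lean` (00:45Z): `grossLSeries_functional_equation'` — Hecke (8.6) for a
  PRIMITIVE type-`σ^m` datum in the porting seat's currency `HasEmbPowType 𝔪 σ m ψ` / `IsPrimitiveGross 𝔪 ψ σ m` — PROVED (this was g12's M4′);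
* `GaloisRepresentations/HeckeCharacterConductorRayPrimitive.lean` (00:55Z): `HeckeCharacter.conductor_eq_of_forall_idealPow_span_eq` — the
  finite character of an algebraic Hecke character is PRIMITIVE modulo its conductor (ray form) — PROVED (this was the core of g12's M5c/M5e).

So the named fact was left as ONLY the idelic ↔ ideal-theoretic DICTIONARY AT THE CONDUCTOR, and that dictionary turns out to be glue over tree
theorems: this file states it as four small lemmas (N5a `heckeLFunction_eq_rayClassLSeries_conductor`, N5b `heckeLFunctionConj_eq_rayClassLSeries_star_conductor`,
N5c `hasEmbPowType_conductor` (+ the general-modulus N5c′ `hasEmbPowType_of_isGrossencharakter`), N5d `isPrimitiveGross_conductor`; template = the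
finite-order sibling `heckeLFunction_functional_equation_of_isFiniteOrder`) and PROVES them, and the assembly
★ `heckeFE_conductor_holds_of_dictionary : Hecke_functionalEquation_infinityType_conductor` is SORRY-FREE (`lean check` rc 0, 0 sorries;
`#print axioms` = `[propext, Classical.choice, Quot.sound]`, 2026-09-01T01:10Z), hence also
★ `shimura1972_holds_of_dictionary : ModularForms.shimura1972_heckeTheta_isNewform0_of_primitive` and
`heckeFE_infinityType_holds_of_dictionary : Hecke_functionalEquation_infinityType` (the existential-`B` sibling) — all unconditional.
LANDED INDEPENDENTLY (seen 01:15Z): `Literature/NumberTheory/EllipticCurves/HeckeGrossencharakterFunctionalEquationConductorProofs.lean` (BSD-side seat,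
2026-09-01T00:58Z) proves `Hecke_functionalEquation_infinityType_conductor_holds` by the same dictionary (same lemma names N5a–N5d); THIS file is an
independent kernel confirmation written in parallel.  STILL TO LAND for this stub (one line, S): `ModularForms.shimura1972_heckeTheta_isNewform0_of_primitive_holds :=
shimura1972_heckeTheta_isNewform0_of_primitive_of_heckeFE Hecke_functionalEquation_infinityType_conductor_holds` as
`Literature/NumberTheory/EllipticCurves/CMNewformGamma0PrimitiveIsNewformHolds.lean` (`rg` first), `--supports stmt-ABC-11340`.
Downstream for THIS stub (g10/g11 companions, kernel-checked there): `TwoGroupBranch ⇐ twoGroupBranch_of_shimura shimura1972_holds_of_dictionary`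
modulo the g10 bricks E0–E5 only — the 2-group half of `stub_modThree` no longer owes any named Literature fact.
-/

noncomputable section

open scoped ComplexConjugate NumberField
open NumberField NumberField.InfinitePlace IsDedekindDomain
open Literature.NumberTheory.GaloisRepresentations Literature.NumberTheory.EllipticCurves
open Literature.NumberTheory.LFunctions (rayClassLSeries idealPow HasEmbPowType IsPrimitiveGross grossFinitePart)

namespace Summit.ABC.ABC.Cruxes.FreyModularity.Sketch.StubModThreeIdeasK1G13

/-! ## §0. Landed since generation 12 (sanity references; sorry-free tree theorems) -/

example := @Literature.NumberTheory.LFunctions.grossLSeries_functional_equation'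
example := @Literature.NumberTheory.LFunctions.grossLSeries_functional_equation
example := @HeckeCharacter.conductor_eq_of_forall_idealPow_span_eq
example := @ModularForms.shimura1972_heckeTheta_isNewform0_of_primitive_of_heckeFE
example := @Hecke_functionalEquation_infinityType_of_conductor

variable {K : Type} [Field K] [NumberField K]

/-! ## §1. N5a/N5b — the `L`-series side of the dictionary: `L(χ,s)`, `L(χ̄,s)` as conductor-coprime ideal sums -/

/-- A number field has infinitely many finite places (a prime above every rational prime; local copy of the tree's
`infinite_heightOneSpectrum''` of `CMTypeHeckeCharacter.lean`, to keep the imports light). [folklore] -/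
theorem infinite_heightOneSpectrum : Infinite (HeightOneSpectrum (𝓞 K)) := by
  classical
  have hinj : Function.Injective (algebraMap ℤ (𝓞 K)) := (algebraMap ℤ (𝓞 K)).injective_int
  have key : ∀ p : Nat.Primes, ∃ w : HeightOneSpectrum (𝓞 K),
      w.asIdeal.comap (algebraMap ℤ (𝓞 K)) = Ideal.span {(p : ℤ)} := by
    intro p
    have hp : Prime (p : ℤ) := Nat.prime_iff_prime_int.mp p.2
    haveI : (Ideal.span {(p : ℤ)}).IsPrime := (Ideal.span_singleton_prime hp.ne_zero).mpr hp
    obtain ⟨Q, -, hQ, hQp⟩ := Ideal.exists_ideal_over_prime_of_isIntegral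
      (S := 𝓞 K) (Ideal.span {(p : ℤ)}) ⊥
      (by
        rw [← RingHom.ker_eq_comap_bot, (RingHom.injective_iff_ker_eq_bot _).mp hinj]
        exact bot_le)
    refine ⟨⟨Q, hQ, fun hQbot => hp.ne_zero ?_⟩, hQp⟩
    have hmem : (p : ℤ) ∈ Q.comap (algebraMap ℤ (𝓞 K)) := by
      rw [hQp]
      exact Ideal.mem_span_singleton_self _
    rw [hQbot, Ideal.mem_comap, Ideal.mem_bot, map_eq_zero_iff _ hinj] at hmem
    exact hmem
  choose f hf using key
  refine Infinite.of_injective f fun p q hpq => ?_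
  have h := hf p
  rw [hpq, hf q, Ideal.span_singleton_eq_span_singleton, Int.associated_iff_natAbs,
    Int.natAbs_natCast, Int.natAbs_natCast] at h
  exact Subtype.ext h.symm

/-- An unramified finite place exists (the ramified set is finite, the primes are infinite). [folklore] -/
theorem exists_not_mem_ramified (χ : HeckeCharacter K) :
    ∃ v₀ : HeightOneSpectrum (𝓞 K), v₀ ∉ (HeckeCharacter.finite_ramifiedPlaces_holds χ).toFinset := by
  haveI : Infinite (HeightOneSpectrum (𝓞 K)) := infinite_heightOneSpectrum
  exact Infinite.exists_notMem_finset _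

/-- **N5a (S).** `L(χ, s) = Σ_{(𝔞,𝔣(χ))=1} χ̃(𝔞) N𝔞^{-s}` on `re s > m/2 + 1` for an algebraic `χ` of weight `m`
(`2(p_v+q_v) = m·[K_v:ℝ]`; type `(m,0)` or `(0,m)` over an imaginary quadratic field).  Route = the consumer's
`LSeries_thetaCoeff_eq_heckeLFunction`: exponent `-m/2` (`norm_apply_eq_ideleNorm_rpow_of_hasInfinityType`), then
`heckeLFunction_eq_rayClassLSeries_of_norm_eq_rpow` at `𝔪 = 𝔣(χ)` (`conductor_le_asIdeal_iff`). [NeukirchANT1999 VII (8.1); WeilBNT1967 VII §7] -/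
theorem heckeLFunction_eq_rayClassLSeries_conductor {χ : HeckeCharacter K} {p q : InfinitePlace K → ℤ} {m : ℕ}
    (hχ : χ.HasInfinityType p q) (hw : ∀ v : InfinitePlace K, 2 * (p v + q v) = (m : ℤ) * v.mult)
    {s : ℂ} (hs : (m : ℝ) / 2 + 1 < s.re) :
    heckeLFunction χ s = rayClassLSeries χ.conductor (fun v ↦ χ.valueAtUniformizer v) s := by
  classical
  have hmod := HeckeCharacter.isModulus_conductorExponentAt χ
  obtain ⟨v₀, hv₀⟩ := exists_not_mem_ramified χ
  have hσ := HeckeCharacter.norm_apply_eq_ideleNorm_rpow_of_hasInfinityType hχ hmod (wt := (m : ℤ)) hw hv₀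
  have hiff : ∀ v : HeightOneSpectrum (𝓞 K), χ.IsUnramifiedAt v ↔ ¬ χ.conductor ≤ v.asIdeal := fun v ↦ by
    rw [HeckeCharacter.conductor_le_asIdeal_iff, not_not]
  have hs' : 1 - (-((m : ℤ) : ℝ) / 2) < s.re := by push_cast; linarith
  exact HeckeCharacter.heckeLFunction_eq_rayClassLSeries_of_norm_eq_rpow hσ (HeckeCharacter.conductor_ne_bot χ) hiff hs'

/-- **N5b (S, from N5a).** The dual side `L(χ̄, s) = Σ conj(χ̃(𝔞)) N𝔞^{-s}` on `re s > m/2 + 1`: `χ̄` (`HeckeCharacter.conjugate`) has type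
`(q,p)` (`HasInfinityType.conjugate`), the same conductor (`conductor_conjugate`) and values `conj χ(ϖ_v)` (`valueAtUniformizer_conjugate`),
and `heckeLFunction χ̄ = heckeLFunctionConj χ` (`heckeLFunction_conjugate`). [deShalit1987 II.1.1 (3)] -/
theorem heckeLFunctionConj_eq_rayClassLSeries_star_conductor {χ : HeckeCharacter K} {p q : InfinitePlace K → ℤ} {m : ℕ}
    (hχ : χ.HasInfinityType p q) (hw : ∀ v : InfinitePlace K, 2 * (p v + q v) = (m : ℤ) * v.mult)
    {s : ℂ} (hs : (m : ℝ) / 2 + 1 < s.re) :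
    heckeLFunctionConj χ s = rayClassLSeries χ.conductor (star fun v ↦ χ.valueAtUniformizer v) s := by
  have hw' : ∀ v : InfinitePlace K, 2 * (q v + p v) = (m : ℤ) * v.mult := fun v ↦ by rw [add_comm]; exact hw v
  rw [← heckeLFunction_conjugate, heckeLFunction_eq_rayClassLSeries_conductor hχ.conjugate hw' hs,
    HeckeCharacter.conductor_conjugate]
  rfl

/-! ## §2. N5c — the archimedean collapse: `IsGrossencharakter 𝔣 (m,0) ψ` is `HasEmbPowType 𝔣 σ_w m ψ` over an imaginary quadratic field -/

omit [NumberField K] in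
/-- A totally complex field has no ring morphism to `ℝ` (the positivity clauses of the ray relations are void). [folklore] -/
theorem false_of_ringHom_real [NumberField K] [IsTotallyComplex K] (τ : K →+* ℝ) : False := by
  refine IsTotallyComplex.complexEmbedding_not_isReal (Complex.ofRealHom.comp τ) ?_
  rw [ComplexEmbedding.isReal_iff]
  ext x
  simp [ComplexEmbedding.conjugate_coe_eq]

/-- The type-`(m,0)` monomial over an imaginary quadratic field is `σ_{w₀}(a)^m`. [NeukirchANT1999 VII (6.13)] -/
theorem prod_embedding_zpow_nat_zero [IsTotallyComplex K] (h2 : Module.finrank ℚ K = 2) (w₀ : InfinitePlace K) (m : ℕ) (a : K) :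
    ∏ w : InfinitePlace K, w.embedding a ^ ((fun _ ↦ (m : ℤ)) w) * conj (w.embedding a) ^ ((fun _ ↦ (0 : ℤ)) w) =
      w₀.embedding a ^ m := by
  haveI := Literature.NumberTheory.LFunctions.subsingleton_infinitePlace_of_finrank_eq_two (K := K) h2
  rw [Fintype.prod_subsingleton _ w₀]
  simp

/-- **N5c′ (S, general modulus).**  Over an imaginary quadratic field a Größencharakter datum of type `(m,0)` (consumer currency,
`IsGrossencharakter`) is a datum of embedding-power type `σ_{w₀}^m` (porting-seat currency, `HasEmbPowType`). [NeukirchANT1999 VII (6.13)–(6.14)] -/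
theorem hasEmbPowType_of_isGrossencharakter [IsTotallyComplex K] (h2 : Module.finrank ℚ K = 2) (w₀ : InfinitePlace K)
    {𝔣 : Ideal (𝓞 K)} {m : ℕ} {ψ : HeightOneSpectrum (𝓞 K) → ℂ}
    (hψ : IsGrossencharakter 𝔣 (fun _ ↦ (m : ℤ)) (fun _ ↦ 0) ψ) :
    HasEmbPowType 𝔣 w₀.embedding m ψ where
  ne_zero := hψ.ne_zero
  rel b c hb hc hcop hbc := by
    have hbK : (b : K) ≠ 0 := fun h ↦ hb (by exact_mod_cast h)
    have hcK : (c : K) ≠ 0 := fun h ↦ hc (by exact_mod_cast h)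
    have hσc : w₀.embedding (c : K) ^ m ≠ 0 := pow_ne_zero _ ((map_ne_zero _).mpr hcK)
    have h := hψ.idealPow_span_eq b c hb hc hcop hbc (fun τ ↦ (false_of_ringHom_real τ).elim)
    rw [prod_embedding_zpow_nat_zero h2 w₀ m, map_div₀, div_pow] at h
    rw [h, mul_assoc, div_mul_cancel₀ _ hσc]

/-- **N5c (S).** At the conductor: the uniformiser values of `χ` of type `(m,0)` form a `HasEmbPowType 𝔣(χ) σ_{w₀} m` datum
(`isGrossencharakter_valueAtUniformizer_conductor'` + N5c′). [NeukirchANT1999 VII (6.11), (6.14)] -/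
theorem hasEmbPowType_conductor [IsTotallyComplex K] (h2 : Module.finrank ℚ K = 2) (w₀ : InfinitePlace K)
    {χ : HeckeCharacter K} {m : ℕ} (hχ : χ.HasInfinityType (fun _ ↦ (m : ℤ)) (fun _ ↦ 0)) :
    HasEmbPowType χ.conductor w₀.embedding m (fun v ↦ χ.valueAtUniformizer v) :=
  hasEmbPowType_of_isGrossencharakter h2 w₀ (HeckeCharacter.isGrossencharakter_valueAtUniformizer_conductor' hχ)

/-! ## §3. N5d — primitivity at the conductor in the porting seat's currency (`IsPrimitiveGross`) -/

/-- **N5d (S, glue over the 00:55Z theorem).**  `χ_f` of `χ mod 𝔣(χ)` is primitive: for `𝔣(χ) ⊊ 𝔪'` some `b ≡ 1 mod 𝔪'` prime to `𝔣(χ)` has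
`χ_f(b) = χ̃((b))/σ(b)^m ≠ 1` — the contrapositive of `HeckeCharacter.conductor_eq_of_forall_idealPow_span_eq` read through the collapse
`∏_w σ_w(b)^m σ̄_w(b)^0 = σ_{w₀}(b)^m`. [NeukirchANT1999 VII §6 (6.2)–(6.3), (6.11)] -/
theorem isPrimitiveGross_conductor [IsTotallyComplex K] (h2 : Module.finrank ℚ K = 2) (w₀ : InfinitePlace K)
    {χ : HeckeCharacter K} {m : ℕ} (hχ : χ.HasInfinityType (fun _ ↦ (m : ℤ)) (fun _ ↦ 0)) :
    IsPrimitiveGross χ.conductor (fun v ↦ χ.valueAtUniformizer v) w₀.embedding m where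
  exists_ne_one 𝔪' hle hne := by
    classical
    by_contra hcon
    push Not at hcon
    refine hne (HeckeCharacter.conductor_eq_of_forall_idealPow_span_eq hχ hle fun b hb hcop hb1 ↦ ?_)
    have hbK : (b : K) ≠ 0 := fun h ↦ hb (by exact_mod_cast h)
    have hσb : w₀.embedding (b : K) ^ m ≠ 0 := pow_ne_zero _ ((map_ne_zero _).mpr hbK)
    have h1 := hcon b hb hcop hb1
    rw [Literature.NumberTheory.LFunctions.grossFinitePart_of_isCoprime hb hcop, div_eq_one_iff_eq hσb] at h1
    rw [prod_embedding_zpow_nat_zero h2 w₀ m, h1]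

/-! ## §4. Assembly: the named fact from N5a–N5d + `grossLSeries_functional_equation'` (kernel-checked) -/

/-- An imaginary quadratic field has a complex place (indeed exactly one). [folklore] -/
theorem exists_isComplex_of_isImaginaryQuadratic (hK : IsImaginaryQuadratic K) : ∃ w : InfinitePlace K, w.IsComplex := by
  haveI : IsTotallyComplex K := hK.2
  obtain ⟨w⟩ := (inferInstance : Nonempty (InfinitePlace K))
  exact ⟨w, IsTotallyComplex.isComplex w⟩

/-- ★ **`Hecke_functionalEquation_infinityType_conductor` HOLDS** (sorry-free; de Shalit II.1.1 (1)–(3), Neukirch VII (8.5)–(8.6), Hecke 1920):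
Hecke (8.6) in the porting seat's currency (`grossLSeries_functional_equation'`, 2026-09-01T00:45Z) at `𝔪 := 𝔣(χ)`, `ψ := χ(ϖ_·)`, `σ := σ_{w₀}`
(N5c, N5d), rewritten through N5a/N5b.  Template: `heckeLFunction_functional_equation_of_isFiniteOrder`. [NeukirchANT1999 VII (8.6); deShalit1987 II.1.1] -/
theorem heckeFE_conductor_holds_of_dictionary : Hecke_functionalEquation_infinityType_conductor := by
  intro K _ _ hK χ m hm hχ
  obtain ⟨h2, htc⟩ := hK
  haveI : IsTotallyComplex K := htc
  obtain ⟨w₀, hw₀⟩ := exists_isComplex_of_isImaginaryQuadratic ⟨h2, htc⟩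
  have hmult : ∀ v : InfinitePlace K, 2 * ((fun _ ↦ (m : ℤ)) v + (fun _ ↦ (0 : ℤ)) v) = (m : ℤ) * v.mult := fun v ↦ by
    rw [InfinitePlace.mult, if_neg (InfinitePlace.not_isReal_iff_isComplex.mpr (IsTotallyComplex.isComplex v))]
    push_cast
    ring
  obtain ⟨W, Λ, Λ', hW, hΛ, hΛ', hval, hFE⟩ :=
    Literature.NumberTheory.LFunctions.grossLSeries_functional_equation' ⟨w₀, hw₀⟩ h2
      (hasEmbPowType_conductor h2 w₀ hχ) (isPrimitiveGross_conductor h2 w₀ hχ) hm (HeckeCharacter.conductor_ne_bot χ)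
  refine ⟨W, Λ, Λ', hW, hΛ, hΛ', fun s hs ↦ ?_, hFE⟩
  obtain ⟨h1, h1'⟩ := hval s hs
  exact ⟨by rw [h1, heckeLFunction_eq_rayClassLSeries_conductor hχ hmult hs],
    by rw [h1', heckeLFunctionConj_eq_rayClassLSeries_star_conductor hχ hmult hs]⟩

/-- ★ Consequence (sorry-free): the residual named fact of the 2-group half, `ModularForms.shimura1972_heckeTheta_isNewform0_of_primitive`
(the theta series of a primitive Größencharakter is a newform of level EXACTLY `|d_K|·N𝔣`), HOLDS. [Ribet1977Nebentypus §3; Shimura 1971/72] -/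
theorem shimura1972_holds_of_dictionary : ModularForms.shimura1972_heckeTheta_isNewform0_of_primitive :=
  ModularForms.shimura1972_heckeTheta_isNewform0_of_primitive_of_heckeFE heckeFE_conductor_holds_of_dictionary

/-- The existential-`B` sibling fact `Hecke_functionalEquation_infinityType` HOLDS too (sorry-free). [deShalit1987 II.1.1] -/
theorem heckeFE_infinityType_holds_of_dictionary : Hecke_functionalEquation_infinityType :=
  Hecke_functionalEquation_infinityType_of_conductor heckeFE_conductor_holds_of_dictionary

end Summit.ABC.ABC.Cruxes.FreyModularity.Sketch.StubModThreeIdeasK1G13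

end
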